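import Summits.HubbardSuperconductivity.HubbardSuperconductivity.Theorems.BalabanIRBirGroundStateAverageLROSoftminSocketEquiv
import Summits.HubbardSuperconductivity.HubbardSuperconductivity.Theorems.BalabanIRBirEveryGroundStateSocket

/-!
# Route BalabanIR — crux `BirGroundStateAverageLRO` (item `stmt-HubbardSuperconductivity-2079`), line `Sketch`:
# the line's only stub implies the SUMMIT (kernel certificate of the line-dead verdict)

Line `Sketch` (idea `softmin-pair-penalty`, registered skeleton `Cruxes/BirGroundStateAverageLRO/Lines/Sketch.lean`)
closes the crux modulo ONE stub, `stub_freePenalisedFloor`: for some `δ ∈ (0,1/2)`, window `0 < U₁ < U₂`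
and floor `x > 0`, for every `U` in the window, eventually in even `L`, the canonical
`(2⌊(1-δ)L²/2⌋, S^z = 0)` Gibbs state of the penalised torus `hubbardTorus 2 L 1 U + (κ/L⁴) Δ_d†Δ_d`
at a free schedule `(β, κ, σ)` with budget `4σ ≤ βκx` has `⟨Δ_d†Δ_d⟩ ≥ xL⁴`.

`BalabanIRBirGroundStateAverageLROSoftminSocketEquiv` proved that these data are EQUIVALENT (constants
`2`, `8`) to every-ground-state `d`-wave pair order on the window. This file draws the consequence
that matters for the line census: the stub implies not only the crux (`stub_transferFree`, landed) but
the summit `HubbardSuperconductivity` itself —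

* `hasLRO_of_freeFloorWindow` — the stub's window data give, at EVERY coupling `U` of the window, the
  summit's conclusion at `(U, δ)`: every sequence of normalised sector ground states has `d_{x²-y²}`
  pair-field long-range order (`everyGroundStateLRO_of_freeFloorWindow` + the Griffiths-type bridge
  `forall_hasLRO_iff_groundState_bound`);
* `hubbardSuperconductivity_of_freeFloorWindow` — hence `HubbardSuperconductivity` (take the midpoint
  coupling of the window);
* `freePenalisedFloorSummit` — registered form: (statement of `stub_freePenalisedFloor`, verbatim)
  `→ HubbardSuperconductivity`;
* `freePenalisedFloor_imp_crux_and_summit` — (stub) `→ BirGroundStateAverageLRO ∧ HubbardSuperconductivity`.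

So the residual stub of line `Sketch` is summit-strength (indeed stronger: a whole window of couplings
with a uniform constant): the line is complete as bookkeeping and dead as a reduction. Nothing about
the Hubbard model is proved here; every statement is a closed implication.

Sources: D. J. Scalapino, Phys. Rep. 250 (1995) 329, §2 eq. (2.4) (the order functional);
R. B. Griffiths, J. Math. Phys. 5 (1964) 1215, §III; H. Tasaki (2020) App. A. Folklore; no
definition is introduced.
-/

noncomputable section

namespace Summit.HubbardSuperconductivity.HubbardSuperconductivity.Theorems.BirGroundStateAverageLRO.Softmin

open Matrix Finset Filter Literature.MathematicalPhysics.QuantumLattice Literature.Probability.LatticeModels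
open Summit.HubbardSuperconductivity.HubbardSuperconductivity.Theses.BalabanIR
open Summit.HubbardSuperconductivity.HubbardSuperconductivity.Theorems
open scoped ComplexOrder

section Hubbard

/-- **The free-socket data on a window give the summit's conclusion at every coupling of the
window.** If the data of `stub_freePenalisedFloor` hold with floor `x > 0` for every `U ∈ (U₁, U₂)`
(eventually in even `L`), then for every such `U` EVERY sequence `ψ_L` of normalised ground states of
`hubbardTorus 2 L 1 U` in the sectors `(2⌊(1-δ)L²/2⌋, S^z = 0)` has `d_{x²-y²}` pair-field long-range
order along even sides (`HasLongRangeOrder` of `torusPullback (pairFieldCorr dWaveFormFactor ψ) (2k)`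
over `halfOpenBox 2 (2k)`) — the body of `Literature.Hubbard.DWaveSuperconductivityHubbard` at
`(U, δ)`. Proof: `everyGroundStateLRO_of_freeFloorWindow` (every-GS order `x/2`) and
`forall_hasLRO_iff_groundState_bound`. [folklore] -/
theorem hasLRO_of_freeFloorWindow (δ U₁ U₂ x : ℝ) (hδ : δ ∈ Set.Ioo (0 : ℝ) (1 / 2)) (hx : 0 < x)
    (h : ∀ U ∈ Set.Ioo U₁ U₂, ∃ L₀ : ℕ, ∀ (L : ℕ) [NeZero L], L₀ ≤ L → Even L →
      let N : ℕ := 2 * ⌊(1 - δ) * (L : ℝ) ^ 2 / 2⌋₊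
      let H := hubbardTorus 2 L 1 U
      let S := szSector (Λ := FermionTorus 2 L) N 0
      let P := projMatrix (S.map (Fock.toEuclidean (ι := Orb (FermionTorus 2 L)) :
        Fock (Orb (FermionTorus 2 L)) →ₗ[ℂ] EuclideanSpace ℂ (Finset (Orb (FermionTorus 2 L)))))
      let A := (pairField dWaveFormFactor L)ᴴ * pairField dWaveFormFactor L
      let e : ℝ := H.minEnergyOn S
      ∃ β κ σ : ℝ, 0 < β ∧ 0 < κ ∧ 4 * σ ≤ β * κ * x ∧
        x * (L : ℝ) ^ 4 * (P * gibbsWeight β (H + ((κ / (L : ℝ) ^ 4 : ℝ) : ℂ) • A)).trace.re ≤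
          (P * gibbsWeight β (H + ((κ / (L : ℝ) ^ 4 : ℝ) : ℂ) • A) * A).trace.re ∧
        (Real.log ((P * gibbsWeight β (H - ((e : ℝ) : ℂ) • 1)).trace.re) ≤ σ ∨
          (L : ℝ) ^ 2 * Real.log 4 ≤ σ)) :
    ∀ U ∈ Set.Ioo U₁ U₂, ∀ (N : ℕ → ℕ) (ψ : ∀ L, Fock (Orb (FermionTorus 2 L))),
      (∀ L, Even L → N L = 2 * ⌊(1 - δ) * (L : ℝ) ^ 2 / 2⌋₊ ∧ star (ψ L) ⬝ᵥ ψ L = 1 ∧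
        IsGroundStateInSector (hubbardTorus 2 L 1 U) (N L) 0 (ψ L)) →
      HasLongRangeOrder (fun k => halfOpenBox 2 (2 * k))
        (fun k => torusPullback (pairFieldCorr dWaveFormFactor ψ) (2 * k)) := by
  intro U hU
  have hevery := everyGroundStateLRO_of_freeFloorWindow δ U₁ U₂ x hx h U hU
  obtain ⟨L₀, hL₀⟩ := hevery
  have hδ' : (-1 : ℝ) ≤ δ := by linarith [hδ.1]
  exact (forall_hasLRO_iff_groundState_bound U δ hδ').2
    ⟨x / 2, by positivity, L₀, fun L _ hL hLe ψ hψ hn => hL₀ L hL hLe ψ hψ hn⟩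

/-- **The free-socket data on a window of repulsive couplings give the summit.** If for some
`δ ∈ (0, 1/2)`, some window `0 < U₁ < U₂` and some floor `x > 0` the data of `stub_freePenalisedFloor`
hold, then `HubbardSuperconductivity`: at the midpoint coupling `U = (U₁ + U₂)/2 > 0` and doping `δ`,
`hasLRO_of_freeFloorWindow` is the body of `Literature.Hubbard.DWaveSuperconductivityHubbard`.
Conditional on its hypothesis (nothing about the Hubbard model is proved here). [folklore] -/
theorem hubbardSuperconductivity_of_freeFloorWindow
    (h : ∃ δ ∈ Set.Ioo (0 : ℝ) (1 / 2), ∃ U₁ U₂ x : ℝ, 0 < U₁ ∧ U₁ < U₂ ∧ 0 < x ∧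
      ∀ U ∈ Set.Ioo U₁ U₂, ∃ L₀ : ℕ, ∀ (L : ℕ) [NeZero L], L₀ ≤ L → Even L →
        let N : ℕ := 2 * ⌊(1 - δ) * (L : ℝ) ^ 2 / 2⌋₊
        let H := hubbardTorus 2 L 1 U
        let S := szSector (Λ := FermionTorus 2 L) N 0
        let P := projMatrix (S.map (Fock.toEuclidean (ι := Orb (FermionTorus 2 L)) :
          Fock (Orb (FermionTorus 2 L)) →ₗ[ℂ] EuclideanSpace ℂ (Finset (Orb (FermionTorus 2 L)))))
        let A := (pairField dWaveFormFactor L)ᴴ * pairField dWaveFormFactor L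
        let e : ℝ := H.minEnergyOn S
        ∃ β κ σ : ℝ, 0 < β ∧ 0 < κ ∧ 4 * σ ≤ β * κ * x ∧
          x * (L : ℝ) ^ 4 * (P * gibbsWeight β (H + ((κ / (L : ℝ) ^ 4 : ℝ) : ℂ) • A)).trace.re ≤
            (P * gibbsWeight β (H + ((κ / (L : ℝ) ^ 4 : ℝ) : ℂ) • A) * A).trace.re ∧
          (Real.log ((P * gibbsWeight β (H - ((e : ℝ) : ℂ) • 1)).trace.re) ≤ σ ∨
            (L : ℝ) ^ 2 * Real.log 4 ≤ σ)) :
    _root_.HubbardSuperconductivity := by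
  obtain ⟨δ, hδ, U₁, U₂, x, hU₁, hU₁₂, hx, h⟩ := h
  have hmid : (U₁ + U₂) / 2 ∈ Set.Ioo U₁ U₂ := ⟨by linarith, by linarith⟩
  show Literature.Hubbard.DWaveSuperconductivityHubbard
  exact ⟨(U₁ + U₂) / 2, by linarith, δ, hδ,
    hasLRO_of_freeFloorWindow δ U₁ U₂ x hδ hx h _ hmid⟩

/-- **Registered form — the only stub of line `Sketch` implies the summit.** The statement of
`stub_freePenalisedFloor` (skeleton `Cruxes/BirGroundStateAverageLRO/Lines/Sketch.lean`, item
`stmt-HubbardSuperconductivity-2079`), verbatim, `→ HubbardSuperconductivity`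
(`hubbardSuperconductivity_of_freeFloorWindow`). Certificate that the stub is summit-strength: the
line is complete as bookkeeping and dead as a reduction of the crux. [folklore] -/
theorem freePenalisedFloorSummit : (∃ δ ∈ Set.Ioo (0 : ℝ) (1 / 2), ∃ U₁ U₂ x : ℝ, 0 < U₁ ∧ U₁ < U₂ ∧ 0 < x ∧ ∀ U ∈ Set.Ioo U₁ U₂, ∃ L₀ : ℕ, ∀ (L : ℕ) [NeZero L], L₀ ≤ L → Even L → let N : ℕ := 2 * ⌊(1 - δ) * (L : ℝ) ^ 2 / 2⌋₊; let H := Literature.MathematicalPhysics.QuantumLattice.hubbardTorus 2 L 1 U; let S := Literature.MathematicalPhysics.QuantumLattice.szSector (Λ := Literature.MathematicalPhysics.QuantumLattice.FermionTorus 2 L) N 0; let P := Literature.MathematicalPhysics.QuantumLattice.projMatrix (S.map (Literature.MathematicalPhysics.QuantumLattice.Fock.toEuclidean (ι := Literature.MathematicalPhysics.QuantumLattice.Orb (Literature.MathematicalPhysics.QuantumLattice.FermionTorus 2 L)) : Literature.MathematicalPhysics.QuantumLattice.Fock (Literature.MathematicalPhysics.QuantumLattice.Orb (Literature.MathematicalPhysics.QuantumLattice.FermionTorus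 2 L)) →ₗ[ℂ] EuclideanSpace ℂ (Finset (Literature.MathematicalPhysics.QuantumLattice.Orb (Literature.MathematicalPhysics.QuantumLattice.FermionTorus 2 L))))); let A := Matrix.conjTranspose (Literature.MathematicalPhysics.QuantumLattice.pairField Literature.MathematicalPhysics.QuantumLattice.dWaveFormFactor L) * Literature.MathematicalPhysics.QuantumLattice.pairField Literature.MathematicalPhysics.QuantumLattice.dWaveFormFactor L; let e : ℝ := H.minEnergyOn S; ∃ β κ σ : ℝ, 0 < β ∧ 0 < κ ∧ 4 * σ ≤ β * κ * x ∧ x * (L : ℝ) ^ 4 * (P * Matrix.gibbsWeight β (H + ((κ / (L : ℝ) ^ 4 : ℝ) : ℂ) • A)).trace.re ≤ (P * Matrix.gibbsWeight β (H + ((κ / (L : ℝ) ^ 4 : ℝ) : ℂ) • A) * A).trace.re ∧ (Real.log ((P * Matrix.gibbsWeight β (H - ((e : ℝ) : ℂ) • 1)).trace.re) ≤ σ ∨ (L : ℝ) ^ 2 * Real.log 4 ≤ σ)) → HubbardSuperconductivity :=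
  fun h => hubbardSuperconductivity_of_freeFloorWindow h

/-- **The only stub of line `Sketch` implies the crux AND the summit.** (Crux: the landed free-schedule
transfer `stub_transferFree`; summit: `hubbardSuperconductivity_of_freeFloorWindow`.) [folklore] -/
theorem freePenalisedFloor_imp_crux_and_summit
    (h : ∃ δ ∈ Set.Ioo (0 : ℝ) (1 / 2), ∃ U₁ U₂ x : ℝ, 0 < U₁ ∧ U₁ < U₂ ∧ 0 < x ∧
      ∀ U ∈ Set.Ioo U₁ U₂, ∃ L₀ : ℕ, ∀ (L : ℕ) [NeZero L], L₀ ≤ L → Even L →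
        let N : ℕ := 2 * ⌊(1 - δ) * (L : ℝ) ^ 2 / 2⌋₊
        let H := hubbardTorus 2 L 1 U
        let S := szSector (Λ := FermionTorus 2 L) N 0
        let P := projMatrix (S.map (Fock.toEuclidean (ι := Orb (FermionTorus 2 L)) :
          Fock (Orb (FermionTorus 2 L)) →ₗ[ℂ] EuclideanSpace ℂ (Finset (Orb (FermionTorus 2 L)))))
        let A := (pairField dWaveFormFactor L)ᴴ * pairField dWaveFormFactor L
        let e : ℝ := H.minEnergyOn S
        ∃ β κ σ : ℝ, 0 < β ∧ 0 < κ ∧ 4 * σ ≤ β * κ * x ∧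
          x * (L : ℝ) ^ 4 * (P * gibbsWeight β (H + ((κ / (L : ℝ) ^ 4 : ℝ) : ℂ) • A)).trace.re ≤
            (P * gibbsWeight β (H + ((κ / (L : ℝ) ^ 4 : ℝ) : ℂ) • A) * A).trace.re ∧
          (Real.log ((P * gibbsWeight β (H - ((e : ℝ) : ℂ) • 1)).trace.re) ≤ σ ∨
            (L : ℝ) ^ 2 * Real.log 4 ≤ σ)) :
    BirGroundStateAverageLRO ∧ _root_.HubbardSuperconductivity := by
  refine ⟨?_, hubbardSuperconductivity_of_freeFloorWindow h⟩
  obtain ⟨δ, hδ, U₁, U₂, x, hU₁, hU₁₂, hx, h⟩ := h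
  exact stub_transferFree δ U₁ U₂ x hδ hU₁ hU₁₂ hx h

end Hubbard

end Summit.HubbardSuperconductivity.HubbardSuperconductivity.Theorems.BirGroundStateAverageLRO.Softmin
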